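import Literature.MathematicalPhysics.QuantumLattice.HubbardOpenBoxCodedClusterCertificateBlocks
import Literature.MathematicalPhysics.QuantumLattice.HubbardOpenBoxEDUpperCertificateAxial2
import HarnessLib

/-!
# The coded cluster oracle of the open `t–t'–t''` cluster (kernel ED floors exact in the third-neighbour hopping)

Topic `MathematicalPhysics/QuantumLattice`, family `hubbard`. The instance of the generic data-free floor chain
(`HubbardOpenBoxCodedClusterRows` / `…Certificate` / `…CertificateBlocks`) for Pavarini's one-band `t–t'–t''` model
on the open `a × b` cluster, `hubbardOpenBoxTT'T'' a b t t' t'' U` (`HubbardTPPBoxHamiltonian`: the `t–t'` box plus the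
axial range-2 bonds `rectBoxAxial2Graph`), at rational couplings `(TN/Q, TD/Q, T3/Q, UU/Q)`. Its floor tables
`σ k ≤ E₀(h_{2×3}(t/7, t'/4, t''/2, U/12), k)` are the hypothesis of the infinite-volume Anderson bound for object M,
`InfVolFermionState.tiGroundEnergyDensityAt_tpp_ge_of_boxFloors_2x3_oneTable` (exact in `t''`).

* §1 the coded entries `hzInt₃ = hzInt − T3·openBoxHop(ax2)` (dictionary `hubbardOpenBoxTT'T''_apply_eq_hzInt₃{_div}`,
  symmetry, bound `hzBound₃`), the coded application (`hubbardOpenBoxTT'T''_mulVec_code{_div}`), spin-exchange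
  invariance and sector preservation of the `t–t'–t''` cluster;
* §2 the ORACLE **`tppCluster a b TN TD T3 UU : CodedCluster`**, its semantics **`tppCluster_models`**, and the
  certificate form **`groundEnergy_ge_of_kCertsTPP₃`** (`KCert.PassesG`, sectors `p ≤ q`) ⇒
  `σ ≤ E₀(h^{tt't''}_{a×b}(TN/Q, TD/Q, T3/Q, UU/Q), k)`.

Everything is proved; no named fact; nothing numerical is asserted here.

## References

* E. Pavarini, I. Dasgupta, T. Saha-Dasgupta, O. Jepsen, O. K. Andersen, PRL 87 (2001) 047003, eq. (1).
  [cite: PavariniEtAl2001, eq. (1)]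
* H. Q. Lin, J. E. Gubernatis, Comput. Phys. 7 (1993) 400, §II. [cite: LinGubernatis1993, §II]
* I. Kull, N. Schuch, B. Dive, M. Navascués, PRX 14 (2024) 021008, §5.3. [cite: KullEtAl2024, §5.3]
* E. H. Lieb, PRL 62 (1989) 1201, proof of Thm 1 (spin exchange). [cite: LiebPRL1989, proof of Theorem 1]
-/

noncomputable section

namespace Literature.MathematicalPhysics.QuantumLattice

namespace OccupationCode

open Finset Matrix HubbardWave0 ThermodynamicLimit Literature.Computation.Certificates

/-! ### §1 Coded entries and coded application of the `t–t'–t''` cluster -/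

/-- **The integer-coded entry function of the `t–t'–t''` cluster**: `hzInt₃ = hzInt − T3·openBoxHop(axial-2 bonds)`
(`= Q ·` the entry of `h^{tt't''}(TN/Q, TD/Q, T3/Q, UU/Q)`). [cite: LinGubernatis1993, §II] [cite: PavariniEtAl2001, eq. (1)] -/
def hzInt₃ (a b : ℕ) (TN TD T3 UU : ℤ) (m m' : ℕ) : ℤ :=
  hzInt a b TN TD UU m m' - T3 * openBoxHop (ax2AdjCode b) (a * b) m m'

/-- The a-priori bound `|hzInt₃| ≤ hzBound + |T3|·2(ab)²`. [cite: LinGubernatis1993, §II] -/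
def hzBound₃ (N : ℕ) (TN TD T3 UU : ℤ) : ℕ :=
  hzBound N TN TD UU + T3.natAbs * (2 * N * N)

/-- **THE ORACLE of the `t–t'–t''` cluster** `Q·h^{tt't''}_{a×b}(TN/Q, TD/Q, T3/Q, UU/Q)`: coded application by the three
adjacency lists (nearest-neighbour, diagonal, axial range-2) and the double occupancy; bound `hzBound₃`.
[cite: LinGubernatis1993, §II] [cite: PavariniEtAl2001, eq. (1)] -/
def tppCluster (a b : ℕ) (TN TD T3 UU : ℤ) : CodedCluster where
  app m f := -TN * hopListSum m f (hopOrbs (nnAdjCode b) (a * b)) - TD * hopListSum m f (hopOrbs (diagAdjCode b) (a * b))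
    - T3 * hopListSum m f (hopOrbs (ax2AdjCode b) (a * b)) + UU * (doccOf (a * b) m * f m)
  bound := hzBound₃ (a * b) TN TD T3 UU

section Box

variable {a b : ℕ}

/-- **Entry dictionary (real couplings)**: `h^{tt't''}(t, t', t'', U) s s' = −t·hopNN − t'·hopDiag − t''·hopAx2 + U·docc`
on the codes. [cite: LinGubernatis1993, §II] [cite: PavariniEtAl2001, eq. (1)] -/
theorem hubbardOpenBoxTT'T''_apply_eq_code (t t' t'' U : ℝ) (s s' : Finset (Orb (Fin a ×ₗ Fin b))) :
    hubbardOpenBoxTT'T'' a b t t' t'' U s s' =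
      (((-t * openBoxHopNN a b (code s) (code s') - t' * openBoxHopDiag a b (code s) (code s') +
        U * doccCode a b (code s) (code s') - t'' * openBoxHop (ax2AdjCode b) (a * b) (code s) (code s') : ℝ)) : ℂ) := by
  rw [hubbardOpenBoxTT'T''_def, Matrix.add_apply, hubbardOpenBoxTT'_apply_eq_code, hamiltonian_apply,
    sum_hop_eq_openBoxHop _ (ax2AdjCode b) ax2AdjCode_siteRank]
  push_cast
  ring

/-- **Entry dictionary (integer couplings)**: `h^{tt't''}(TN, TD, T3, UU) s s' = hzInt₃ (code s) (code s')`.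
[cite: LinGubernatis1993, §II] -/
theorem hubbardOpenBoxTT'T''_apply_eq_hzInt₃ (TN TD T3 UU : ℤ) (s s' : Finset (Orb (Fin a ×ₗ Fin b))) :
    hubbardOpenBoxTT'T'' a b (TN : ℝ) (TD : ℝ) (T3 : ℝ) (UU : ℝ) s s' = ((hzInt₃ a b TN TD T3 UU (code s) (code s') : ℝ) : ℂ) := by
  rw [hubbardOpenBoxTT'T''_apply_eq_code, hzInt₃, hzInt, openBoxHopNN, openBoxHopDiag]
  push_cast
  ring

/-- **Entry dictionary (rational couplings)**: `h^{tt't''}(TN/Q, TD/Q, T3/Q, UU/Q) s s' = hzInt₃ (code s) (code s') / Q`.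
[cite: LinGubernatis1993, §II] -/
theorem hubbardOpenBoxTT'T''_apply_eq_hzInt₃_div (TN TD T3 UU : ℤ) (Q : ℕ) (s s' : Finset (Orb (Fin a ×ₗ Fin b))) :
    hubbardOpenBoxTT'T'' a b ((TN : ℝ) / Q) ((TD : ℝ) / Q) ((T3 : ℝ) / Q) ((UU : ℝ) / Q) s s' =
      ((hzInt₃ a b TN TD T3 UU (code s) (code s') : ℝ) : ℂ) / ((Q : ℝ) : ℂ) := by
  rw [hubbardOpenBoxTT'T''_apply_eq_code, hzInt₃, hzInt, openBoxHopNN, openBoxHopDiag]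
  push_cast
  ring

/-- **Symmetry** of the coded entries on configurations (the cluster Hamiltonian is Hermitian with real entries).
[cite: LinGubernatis1993, §II] -/
theorem hzInt₃_code_symm (TN TD T3 UU : ℤ) (s s' : Finset (Orb (Fin a ×ₗ Fin b))) :
    hzInt₃ a b TN TD T3 UU (code s) (code s') = hzInt₃ a b TN TD T3 UU (code s') (code s) := by
  have hH : (hubbardOpenBoxTT'T'' a b (TN : ℝ) (TD : ℝ) (T3 : ℝ) (UU : ℝ)).IsHermitian := by
    rw [hubbardOpenBoxTT'T''_def]
    exact (hubbardOpenBoxTT'_isHermitian a b _ _ _).add (LiebThm1.hamiltonian_isHermitian _ _ _)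
  have h := hH.apply s s'
  rw [hubbardOpenBoxTT'T''_apply_eq_hzInt₃, hubbardOpenBoxTT'T''_apply_eq_hzInt₃, RCLike.star_def, Complex.conj_ofReal] at h
  exact_mod_cast h.symm

/-- Structural sums of bounded integers are bounded. [folklore] -/
private theorem abs_sumNat_le' (f : ℕ → ℤ) (c : ℤ) (hf : ∀ i, |f i| ≤ c) : ∀ n : ℕ, |sumNat f n| ≤ n * c
  | 0 => by simp [sumNat]
  | n + 1 => by
      rw [sumNat]
      calc |sumNat f n + f n| ≤ |sumNat f n| + |f n| := abs_add_le _ _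
        _ ≤ n * c + c := add_le_add (abs_sumNat_le' f c hf n) (hf n)
        _ = (n + 1 : ℕ) * c := by push_cast; ring

/-- `|openBoxHop adj N m m'| ≤ 2N²`. [cite: LinGubernatis1993, §II] -/
private theorem abs_openBoxHop_le' (adj : ℕ → ℕ → Bool) (N m m' : ℕ) :
    |openBoxHop adj N m m'| ≤ (N : ℤ) * (N * 2) := by
  unfold openBoxHop
  refine abs_sumNat_le' _ _ (fun P => ?_) N
  refine abs_sumNat_le' _ _ (fun Q => ?_) N
  split_ifs
  · have := abs_sumNat_le' (fun σ => hopCode (2 * P + σ) (2 * Q + σ) m m') 1 (fun σ => by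
      unfold hopCode; split_ifs <;> simp) 2
    simpa using this
  · simp

/-- **`|hzInt₃| ≤ hzBound₃`.** [cite: LinGubernatis1993, §II] -/
theorem abs_hzInt₃_le (TN TD T3 UU : ℤ) (m m' : ℕ) :
    |hzInt₃ a b TN TD T3 UU m m'| ≤ (hzBound₃ (a * b) TN TD T3 UU : ℤ) := by
  unfold hzInt₃ hzBound₃
  have h1 := abs_hzInt_le (a := a) (b := b) TN TD UU m m'
  have h2 := abs_openBoxHop_le' (ax2AdjCode b) (a * b) m m'
  have h3 : |T3 * openBoxHop (ax2AdjCode b) (a * b) m m'| ≤ |T3| * ((a * b : ℕ) * ((a * b : ℕ) * 2)) := by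
    rw [abs_mul]; exact mul_le_mul_of_nonneg_left h2 (abs_nonneg _)
  refine (abs_sub _ _).trans ?_
  push_cast at h3 ⊢
  linarith

/-- **The `t–t'–t''` cluster Hamiltonian on a coded vector** (integer couplings), in code form:
`(h^{tt't''}(TN,TD,T3,UU) φ_f)(s) = (tppCluster a b TN TD T3 UU).app (code s) f`. [cite: LinGubernatis1993, §II] -/
theorem hubbardOpenBoxTT'T''_mulVec_code (TN TD T3 UU : ℤ) (f : ℕ → ℤ) (s : Finset (Orb (Fin a ×ₗ Fin b))) :
    (hubbardOpenBoxTT'T'' a b (TN : ℝ) (TD : ℝ) (T3 : ℝ) (UU : ℝ) *ᵥ codedVec f) s =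
      (((tppCluster a b TN TD T3 UU).app (code s) f : ℤ) : ℂ) := by
  rw [hubbardOpenBoxTT'T''_def, add_mulVec, Pi.add_apply, hubbardOpenBoxTT'_mulVec_code, hamiltonian_hop_smul,
    Matrix.smul_mulVec, Pi.smul_apply, axial2_hamiltonian_mulVec_codedVec, smul_eq_mul]
  show _ = (((-TN * hopListSum (code s) f (hopOrbs (nnAdjCode b) (a * b))
    - TD * hopListSum (code s) f (hopOrbs (diagAdjCode b) (a * b))
    - T3 * hopListSum (code s) f (hopOrbs (ax2AdjCode b) (a * b)) + UU * (doccOf (a * b) (code s) * f (code s)) : ℤ) : ℤ) : ℂ)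
  rw [hopListSum_hopOrbs, hopListSum_hopOrbs, hopListSum_hopOrbs]
  push_cast
  ring

/-- **The `t–t'–t''` cluster Hamiltonian on a coded vector** (rational couplings): `(h φ_f)(s) = app (code s) f / Q`.
[cite: LinGubernatis1993, §II] -/
theorem hubbardOpenBoxTT'T''_mulVec_code_div (TN TD T3 UU : ℤ) (Q : ℕ) (f : ℕ → ℤ) (s : Finset (Orb (Fin a ×ₗ Fin b))) :
    (hubbardOpenBoxTT'T'' a b ((TN : ℝ) / Q) ((TD : ℝ) / Q) ((T3 : ℝ) / Q) ((UU : ℝ) / Q) *ᵥ codedVec f) s =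
      (((tppCluster a b TN TD T3 UU).app (code s) f : ℝ) : ℂ) / ((Q : ℝ) : ℂ) := by
  rw [hubbardOpenBoxTT'T''_def, add_mulVec, Pi.add_apply, hubbardOpenBoxTT'_mulVec_code, hamiltonian_hop_smul,
    Matrix.smul_mulVec, Pi.smul_apply, axial2_hamiltonian_mulVec_codedVec, smul_eq_mul]
  show _ = ((((-TN * hopListSum (code s) f (hopOrbs (nnAdjCode b) (a * b))
    - TD * hopListSum (code s) f (hopOrbs (diagAdjCode b) (a * b))
    - T3 * hopListSum (code s) f (hopOrbs (ax2AdjCode b) (a * b)) + UU * (doccOf (a * b) (code s) * f (code s)) : ℤ) : ℤ) : ℝ) : ℂ)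
      / ((Q : ℝ) : ℂ)
  rw [hopListSum_hopOrbs, hopListSum_hopOrbs, hopListSum_hopOrbs]
  push_cast
  ring

/-- **The `t–t'–t''` cluster Hamiltonian is spin-exchange invariant.** [cite: LiebPRL1989, proof of Theorem 1] -/
theorem relabel_spinSwap_hubbardOpenBoxTT'T'' (t t' t'' U : ℝ) :
    relabel (Orb.spinSwap : Orb (Fin a ×ₗ Fin b) ≃ Orb (Fin a ×ₗ Fin b)) (hubbardOpenBoxTT'T'' a b t t' t'' U) =
      hubbardOpenBoxTT'T'' a b t t' t'' U := by
  rw [hubbardOpenBoxTT'T''_def, map_add, relabel_spinSwap_hubbardOpenBoxTT', relabel_spinSwap_hamiltonian]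

/-- **The `t–t'–t''` cluster Hamiltonian preserves the spin sectors** `(N↑, N↓)`. [cite: LiebPRL1989, proof of Theorem 1] -/
theorem preservesSectors_hubbardOpenBoxTT'T'' (t t' t'' U : ℝ) : PreservesSectors (hubbardOpenBoxTT'T'' a b t t' t'' U) := by
  rw [hubbardOpenBoxTT'T''_def]
  exact (preservesSectors_hubbardOpenBoxTT' a b t t' U).add (LiebThm1.preservesSectors_hamiltonian _ _ _)

/-! ### §2 The oracle's semantics and the certificate form -/

/-- **SEMANTICS OF THE `t–t'–t''` ORACLE**: `(tppCluster a b TN TD T3 UU).Models a b (hzInt₃ a b TN TD T3 UU) Q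
(h^{tt't''}_{a×b}(TN/Q, TD/Q, T3/Q, UU/Q))`. [cite: LinGubernatis1993, §II] [cite: PavariniEtAl2001, eq. (1)] -/
theorem tppCluster_models (TN TD T3 UU : ℤ) (Q : ℕ) :
    (tppCluster a b TN TD T3 UU).Models a b (hzInt₃ a b TN TD T3 UU) Q
      (hubbardOpenBoxTT'T'' a b ((TN : ℝ) / Q) ((TD : ℝ) / Q) ((T3 : ℝ) / Q) ((UU : ℝ) / Q)) where
  apply_eq s s' := hubbardOpenBoxTT'T''_apply_eq_hzInt₃_div TN TD T3 UU Q s s'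
  mulVec_eq f s := hubbardOpenBoxTT'T''_mulVec_code_div TN TD T3 UU Q f s
  preserves := preservesSectors_hubbardOpenBoxTT'T'' _ _ _ _
  symm s s' := hzInt₃_code_symm TN TD T3 UU s s'
  abs_le m m' := abs_hzInt₃_le TN TD T3 UU m m'

end Box

/-- **Certificate form for the `t–t'–t''` cluster (sectors `p ≤ q`, checks in pieces).** For the open `a × b` cluster with
couplings `(TN/Q, TD/Q, T3/Q, UU/Q)` and a particle number `k ≤ 2ab`: if for every `p ≤ k` with `p ≤ k − p` a data-free
certificate `certs p` with code list `Ls p` of the spin sector `(p, k − p)` PASSES the generic kernel checker for the oracle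
`tppCluster a b TN TD T3 UU` and its floor is `≥ σ`, then `σ ≤ E₀(h^{tt't''}_{a×b}, k)` — the hypothesis of
`InfVolFermionState.tiGroundEnergyDensityAt_tpp_ge_of_boxFloors_2x3_oneTable`. [cite: KullEtAl2024, §5.3] [cite: PavariniEtAl2001, eq. (1)] -/
theorem groundEnergy_ge_of_kCertsTPP₃ (a b : ℕ) (TN TD T3 UU : ℤ) (Q : ℕ) {k : ℕ} (hk : k ≤ 2 * (a * b))
    (σ : ℚ) (Ls : ℕ → List ℕ) (certs : ℕ → KCert)
    (hpass : ∀ p ≤ k, p ≤ k - p → (certs p).PassesG (tppCluster a b TN TD T3 UU) a b p (k - p) Q (Ls p))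
    (hσ : ∀ p ≤ k, p ≤ k - p → σ ≤ (certs p).floor Q) :
    (σ : ℝ) ≤ groundEnergy (hubbardOpenBoxTT'T'' a b ((TN : ℝ) / Q) ((TD : ℝ) / Q) ((T3 : ℝ) / Q) ((UU : ℝ) / Q)) k :=
  groundEnergy_ge_of_kCertsG₃ (tppCluster_models (a := a) (b := b) TN TD T3 UU Q)
    (relabel_spinSwap_hubbardOpenBoxTT'T'' _ _ _ _) hk σ Ls certs hpass hσ

end OccupationCode

end Literature.MathematicalPhysics.QuantumLattice
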